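import Literature.MathematicalPhysics.StatisticalMechanics.NJLClusteringLargeMass
import HarnessLib

/-!
# The mass derivative of the NJL partition functions and the uniform susceptibility bound
# (Salmhofer–Seiler, CMP 139 (1991), §3–§4: the `k = 0` mode of (4.13)–(4.14) at `m > 0`)

A further file of the Salmhofer–Seiler series.  In the proof of the lower bound (4.8) of Theorem 4.3
(p. 418–419) the two-point function `T(ξ) = ⟨σ_0 σ_ξ⟩` at mass `m > 0` is inserted into the
Schwinger–Dyson equation (4.10) through its Fourier transform (4.13); the decomposition
`T̂ = C(0) s² δ + ĝ` used there (`s = ⟨σ_x⟩`) is the statement that the TRUNCATED two-point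
function `⟨σ_0 σ_ξ⟩ - s²` carries no `δ`-mass at `k = 0`, i.e. that the susceptibility
`∑_ξ (⟨σ_0σ_ξ⟩ - ⟨σ_0⟩⟨σ_ξ⟩)` stays bounded — which the paper takes from exponential clustering
(Thm. 3.11).  This file proves that input in finite volume, uniformly in the volume, for every real
mass `m > 0`, directly from analyticity (Heilmann–Lieb) — no cluster expansion, no clustering:

* `hasDerivAt_njlCapZ` — the capacity partition functions of `NJLHoppingLocality` are polynomials in
  the mass with `d/dm Z_Λ(c)(m) = 2N ∑_y Z_Λ(c - δ_y)(m)` (sum over the sites with capacity):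
  Heilmann–Lieb's "`P(G; x_1,…,x_N)` is linear in each vertex activity" (2.9)–(2.12), for the site
  weight `e^{2Nmσ}` of Def. 3.3(1) read through capacities.  Proved by induction on the total
  capacity along the recursion `njlCapZ_rec` ((3.46)/(4.11) of [HeilmannLieb1972]).
* `hasDerivAt_njlCapRatio_top` — hence the **fluctuation formula**
  `d/dm ⟨σ_z⟩_Λ(m) = 2N ∑_y (⟨σ_z σ_y⟩_Λ(m) - ⟨σ_z⟩_Λ(m) ⟨σ_y⟩_Λ(m))` in the zero-free region.
* `norm_deriv_njlCorrelation_single_le` / `njl_susceptibility_bound` — **uniform susceptibility bound**: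
  for real `m > 0`, `|∑_y (⟨σ_zσ_y⟩_Λ - ⟨σ_z⟩_Λ⟨σ_y⟩_Λ)| ≤ 1/(N m²)` in EVERY volume (Cauchy's
  estimate on the disc `|m' - m| < m/2` with the Heilmann–Lieb bound `|⟨σ⟩_Λ(m')| ≤ (2 Re m')⁻¹`
  of the Erratum): the truncated two-point function is summable uniformly in `Λ` ("clustering on
  average") at every `m > 0`, the `k = 0` input of (4.13)–(4.15).

Faithfulness / scope.  `β = 0` NJL statements on the tori `(ℤ/Lℤ)^ν` at complex/real mass, in the
normalisation of `MonomerDimerZeros` (`F = e^{2Nmz}`, capacities `≤ N`).  The printed route to the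
boundedness of the susceptibility is Thm. 3.11 (clustering for all `m ∈ 𝒲`, via subharmonicity);
the route here (analyticity + uniform bounds + Cauchy) is shorter and gives an explicit constant.
Nothing about `β > 0`, the continuum, a mass gap or the summit's `QCD` conjunct.

## References

* M. Salmhofer, E. Seiler, *Proof of chiral symmetry breaking in strongly coupled lattice gauge
  theory*, Commun. Math. Phys. 139 (1991) 395–432: Def. 3.3(1), (3.46), (3.58), Thm. 4.3 with
  (4.10)–(4.15) p. 418–419. [SalmhoferSeiler1991]
* M. Salmhofer, E. Seiler, Erratum, Commun. Math. Phys. 146 (1992) 637–638. [SalmhoferSeiler1992Erratum]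
* O. J. Heilmann, E. H. Lieb, *Theory of monomer-dimer systems*, Commun. Math. Phys. 25 (1972)
  190–232: (2.9)–(2.12) (vertex activities), (4.11), Lemma 4.7. [HeilmannLieb1972]
-/

noncomputable section

open Filter Topology Metric Set Finset

namespace Literature.MathematicalPhysics.StatisticalMechanics

namespace ComplexSpin

open MonomerDimer

open Literature.Probability.LatticeModels (TorusSite Site)
open Literature.Probability.LatticeModels

variable {ν L : ℕ}

/-! ### Capacity bookkeeping -/

/-- Removing capacity keeps the bound `c ≤ N`. [folklore] -/
private theorem tsub_apply_le' {N : ℕ} {c : TorusSite ν L →₀ ℕ} (hc : ∀ x, c x ≤ N)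
    (l : TorusSite ν L →₀ ℕ) (x : TorusSite ν L) : (c - l) x ≤ N := by
  rw [Finsupp.tsub_apply]; exact (Nat.sub_le _ _).trans (hc x)

/-- Removing one unit of capacity lowers the total capacity by one. [folklore] -/
private theorem degree_sub_single_add_one' {c : TorusSite ν L →₀ ℕ} {z : TorusSite ν L}
    (hz : z ∈ c.support) : (c - Finsupp.single z 1).degree + 1 = c.degree := by
  have hle : Finsupp.single z 1 ≤ c :=
    Finsupp.single_le_iff.2 (Nat.one_le_iff_ne_zero.2 (Finsupp.mem_support_iff.1 hz))
  conv_rhs => rw [← tsub_add_cancel_of_le hle]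
  rw [map_add, Finsupp.degree_single]

/-- Two successive removals commute. [folklore] -/
private theorem drop_comm (d : TorusSite ν L →₀ ℕ) (y w : TorusSite ν L) :
    d - Finsupp.single y 1 - Finsupp.single w 1 = d - Finsupp.single w 1 - Finsupp.single y 1 :=
  tsub_right_comm

/-- "`y` can be removed from `d` and then `w`" is symmetric in `y`, `w`. [folklore] -/
private theorem mem_drop_iff (d : TorusSite ν L →₀ ℕ) (y w : TorusSite ν L) :
    (y ∈ d.support ∧ w ∈ (d - Finsupp.single y 1).support) ↔
      (w ∈ d.support ∧ y ∈ (d - Finsupp.single w 1).support) := by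
  simp only [Finsupp.mem_support_iff, Finsupp.tsub_apply, Finsupp.single_apply]
  by_cases hyw : y = w
  · subst hyw; simp
  · rw [if_neg hyw, if_neg (Ne.symm hyw)]
    omega

variable [NeZero L]

/-! ### The dropped-capacity partition functions -/

/-- `Z_Λ(c - δ_y)(m)` if `c` has capacity at `y`, else `0` (`MonomerDimer.Zdrop` of the NJL data, as a
function of the mass): the partition function "with the vertex `(y,·)` deleted", (4.11) of
Heilmann–Lieb. [cite: HeilmannLieb1972, (4.11)][cite: SalmhoferSeiler1991, (3.46)] -/
def njlCapZdrop (N : ℕ) (c : TorusSite ν L →₀ ℕ) (y : TorusSite ν L) (m : ℂ) : ℂ :=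
  if y ∈ c.support then njlCapZ N (c - Finsupp.single y 1) m else 0

/-- `Z_Λ(0)(m) = 1`. [cite: HeilmannLieb1972, (4.19)] -/
theorem njlCapZ_zero' (N : ℕ) (m : ℂ) : njlCapZ N (0 : TorusSite ν L →₀ ℕ) m = 1 :=
  MonomerDimer.Z_zero (fun x => (isExpData_njlSiteData (ν := ν) (L := L) N m x).1)
    (fun b => (isExpData_njlBondData N b).1)

/-! ### The recursion, summed over the removed site -/

section Recursion

variable {N : ℕ} {c : TorusSite ν L →₀ ℕ} {z : TorusSite ν L}

/-- **The recursion applied to every dropped partition function** (pointwise form): for `z` with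
capacity and every `y`,
`c_z Zd(c,y) = [y = z] Z(c-δ_z) + 2Nm Zd(c-δ_z, y) + N [y ∈ supp(c-δ_z)] ∑_μ (Zd(c-δ_z-δ_y, z+e_μ) + Zd(c-δ_z-δ_y, z-e_μ))`.
[cite: HeilmannLieb1972, (4.11)][cite: SalmhoferSeiler1991, (3.46)] -/
theorem natCast_mul_njlCapZdrop_eq (hc : ∀ x, c x ≤ N) (hz : z ∈ c.support) (y : TorusSite ν L)
    (m : ℂ) :
    (c z : ℂ) * njlCapZdrop N c y m =
      (if y = z then njlCapZ N (c - Finsupp.single z 1) m else 0) +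
        2 * N * m * njlCapZdrop N (c - Finsupp.single z 1) y m +
        N * (if y ∈ (c - Finsupp.single z 1).support then
          ∑ μ : Fin ν, (njlCapZdrop N (c - Finsupp.single z 1 - Finsupp.single y 1) (z + Pi.single μ 1) m +
            njlCapZdrop N (c - Finsupp.single z 1 - Finsupp.single y 1) (z - Pi.single μ 1) m) else 0) := by
  classical
  set c' := c - Finsupp.single z 1 with hc'def
  have hcz : 1 ≤ c z := Nat.one_le_iff_ne_zero.2 (Finsupp.mem_support_iff.1 hz)
  by_cases hy : y ∈ c.support
  · by_cases hyz : y = z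
    · -- `y = z`
      subst hyz
      have hdrop : njlCapZdrop N c y m = njlCapZ N c' m := by simp [njlCapZdrop, hy, hc'def]
      rw [hdrop, if_pos rfl]
      by_cases h2 : y ∈ c'.support
      · -- `c_y ≥ 2`: the recursion for `c'` at `y`
        have hrec := njlCapZ_rec N (tsub_apply_le' hc _) h2 m
        rw [← hc'def] at hrec
        have hcy : (c' y : ℂ) = (c y : ℂ) - 1 := by
          have : c' y + 1 = c y := by
            rw [hc'def, Finsupp.tsub_apply, Finsupp.single_eq_same]; omega
          have h := congrArg (fun n : ℕ => (n : ℂ)) this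
          push_cast at h
          linear_combination h
        have hdrop' : njlCapZdrop N c' y m = njlCapZ N (c' - Finsupp.single y 1) m := by
          simp [njlCapZdrop, h2]
        rw [if_pos h2, hdrop']
        simp only [njlCapZdrop] at hrec ⊢
        rw [hcy] at hrec
        linear_combination hrec
      · -- `c_y = 1`: no capacity left at `y`
        have hdrop' : njlCapZdrop N c' y m = 0 := by simp [njlCapZdrop, h2]
        rw [if_neg h2, hdrop']
        have hcy : c y = 1 := by
          rw [Finsupp.mem_support_iff, not_not, hc'def, Finsupp.tsub_apply,
            Finsupp.single_eq_same] at h2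
          omega
        rw [hcy]; push_cast; ring
    · -- `y ≠ z`, `y ∈ supp c`: the recursion for `c - δ_y` at `z`
      have hzy : z ∈ (c - Finsupp.single y 1).support := by
        rw [Finsupp.mem_support_iff, Finsupp.tsub_apply, Finsupp.single_apply, if_neg hyz]
        simpa using Finsupp.mem_support_iff.1 hz
      have hrec := njlCapZ_rec N (tsub_apply_le' hc _) hzy m
      have hcz' : (c - Finsupp.single y 1 : TorusSite ν L →₀ ℕ) z = c z := by
        rw [Finsupp.tsub_apply, Finsupp.single_apply, if_neg hyz, tsub_zero]
      rw [hcz', drop_comm c y z, ← hc'def] at hrec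
      have hy' : y ∈ c'.support := by
        rw [Finsupp.mem_support_iff, hc'def, Finsupp.tsub_apply, Finsupp.single_apply,
          if_neg (Ne.symm hyz), tsub_zero]
        exact Finsupp.mem_support_iff.1 hy
      have hdrop : njlCapZdrop N c y m = njlCapZ N (c - Finsupp.single y 1) m := by
        simp [njlCapZdrop, hy]
      have hdrop' : njlCapZdrop N c' y m = njlCapZ N (c' - Finsupp.single y 1) m := by
        simp [njlCapZdrop, hy']
      rw [hdrop, if_neg hyz, if_pos hy', hdrop', zero_add, hrec]
      simp only [njlCapZdrop]
  · -- `y ∉ supp c`: everything vanishes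
    have hyz : y ≠ z := fun h => hy (h ▸ hz)
    have hy' : y ∉ c'.support := fun h => hy (Finsupp.support_mono (tsub_le_self) h)
    simp [njlCapZdrop, hy, hy', hyz]

/-- The inner double sum is symmetric: `[w ∈ supp d] ∑_u Zd(d-δ_w, u) = ∑_y [y ∈ supp d] Zd(d-δ_y, w)`.
[folklore] -/
private theorem ite_sum_njlCapZdrop_comm (d : TorusSite ν L →₀ ℕ) (w : TorusSite ν L) (m : ℂ) :
    (if w ∈ d.support then ∑ u, njlCapZdrop N (d - Finsupp.single w 1) u m else 0) =
      ∑ y, (if y ∈ d.support then njlCapZdrop N (d - Finsupp.single y 1) w m else 0) := by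
  classical
  have h1 : (if w ∈ d.support then ∑ u, njlCapZdrop N (d - Finsupp.single w 1) u m else 0) =
      ∑ u, (if w ∈ d.support then njlCapZdrop N (d - Finsupp.single w 1) u m else 0) := by
    split_ifs <;> simp
  rw [h1]
  refine Finset.sum_congr rfl fun y _ => ?_
  simp only [njlCapZdrop]
  by_cases hA : w ∈ d.support ∧ y ∈ (d - Finsupp.single w 1).support
  · have hB := (mem_drop_iff d w y).1 hA
    rw [if_pos hA.1, if_pos hA.2, if_pos hB.1, if_pos hB.2, drop_comm]
  · have hB : ¬ (y ∈ d.support ∧ w ∈ (d - Finsupp.single y 1).support) :=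
      fun h => hA ((mem_drop_iff d y w).1 h)
    have hl : (if w ∈ d.support then
        (if y ∈ (d - Finsupp.single w 1).support then
          njlCapZ N (d - Finsupp.single w 1 - Finsupp.single y 1) m else 0) else 0) = 0 := by
      split_ifs with h1 h2
      · exact absurd ⟨h1, h2⟩ hA
      · rfl
      · rfl
    have hr : (if y ∈ d.support then
        (if w ∈ (d - Finsupp.single y 1).support then
          njlCapZ N (d - Finsupp.single y 1 - Finsupp.single w 1) m else 0) else 0) = 0 := by
      split_ifs with h1 h2
      · exact absurd ⟨h1, h2⟩ hB
      · rfl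
      · rfl
    rw [hl, hr]

/-- **The recursion, summed over the removed site**: for `z` with capacity,
`c_z ∑_y Zd(c,y) = Z(c') + 2Nm ∑_y Zd(c',y) + N ∑_μ ([z+e_μ ∈ supp c'] ∑_u Zd(c'-δ_{z+e_μ}, u) + [z-e_μ ∈ supp c'] ∑_u Zd(c'-δ_{z-e_μ}, u))`,
`c' = c - δ_z` — the identity behind `d/dm Z = 2N ∑ Zd`. [cite: HeilmannLieb1972, (4.11) and (2.9)–(2.12)] -/
theorem natCast_mul_sum_njlCapZdrop_eq (hc : ∀ x, c x ≤ N) (hz : z ∈ c.support) (m : ℂ) :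
    (c z : ℂ) * ∑ y, njlCapZdrop N c y m =
      njlCapZ N (c - Finsupp.single z 1) m +
        2 * N * m * ∑ y, njlCapZdrop N (c - Finsupp.single z 1) y m +
        N * ∑ μ : Fin ν,
          ((if z + Pi.single μ 1 ∈ (c - Finsupp.single z 1).support then
              ∑ u, njlCapZdrop N (c - Finsupp.single z 1 - Finsupp.single (z + Pi.single μ 1) 1) u m
            else 0) +
            (if z - Pi.single μ 1 ∈ (c - Finsupp.single z 1).support then
              ∑ u, njlCapZdrop N (c - Finsupp.single z 1 - Finsupp.single (z - Pi.single μ 1) 1) u m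
            else 0)) := by
  classical
  set c' := c - Finsupp.single z 1 with hc'def
  rw [Finset.mul_sum]
  simp_rw [natCast_mul_njlCapZdrop_eq hc hz]
  rw [Finset.sum_add_distrib, Finset.sum_add_distrib, Finset.sum_ite_eq' Finset.univ z,
    if_pos (Finset.mem_univ _), ← Finset.mul_sum, ← Finset.mul_sum]
  congr 1
  congr 1
  -- the double sums: swap `y` and the neighbour
  simp_rw [ite_sum_njlCapZdrop_comm]
  rw [show (∑ μ : Fin ν, ((∑ y, if y ∈ c'.support then
        njlCapZdrop N (c' - Finsupp.single y 1) (z + Pi.single μ 1) m else 0) +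
      (∑ y, if y ∈ c'.support then
        njlCapZdrop N (c' - Finsupp.single y 1) (z - Pi.single μ 1) m else 0))) =
      ∑ μ : Fin ν, ∑ y, ((if y ∈ c'.support then
        njlCapZdrop N (c' - Finsupp.single y 1) (z + Pi.single μ 1) m else 0) +
      (if y ∈ c'.support then
        njlCapZdrop N (c' - Finsupp.single y 1) (z - Pi.single μ 1) m else 0)) from
    Finset.sum_congr rfl fun μ _ => Finset.sum_add_distrib.symm]
  rw [Finset.sum_comm]
  refine Finset.sum_congr rfl fun y _ => ?_
  split_ifs with h
  · rfl
  · simp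

end Recursion

/-! ### The mass derivative of the capacity partition functions -/

section Derivative

variable {N : ℕ}

/-- **`d/dm Z_Λ(c)(m) = 2N ∑_y Zd(c,y)(m)`**: the partition functions are polynomials in the mass
whose derivative removes one unit of capacity at one site — Heilmann–Lieb's "linear in each vertex
activity" (2.9)–(2.12) for the `N` copies of each site, with the site weight `e^{2Nmσ}` of Def. 3.3(1).
Induction on the total capacity along the recursion (4.11)/(3.46). [cite: HeilmannLieb1972, (2.9)–(2.12) and (4.11)][cite: SalmhoferSeiler1991, Def. 3.3(1) and (3.46)] -/
theorem hasDerivAt_njlCapZ (c : TorusSite ν L →₀ ℕ) (hc : ∀ x, c x ≤ N) (m : ℂ) :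
    HasDerivAt (fun m => njlCapZ N c m) (2 * N * ∑ y, njlCapZdrop N c y m) m := by
  classical
  suffices H : ∀ (n : ℕ) (c : TorusSite ν L →₀ ℕ), c.degree = n → (∀ x, c x ≤ N) → ∀ m : ℂ,
      HasDerivAt (fun m => njlCapZ N c m) (2 * N * ∑ y, njlCapZdrop N c y m) m from H _ c rfl hc m
  intro n
  induction n using Nat.strong_induction_on with
  | _ n ih =>
  intro c hdeg hc m
  by_cases h0 : c = 0
  · -- no capacity: `Z = 1`
    subst h0
    have hfun : (fun m : ℂ => njlCapZ N (0 : TorusSite ν L →₀ ℕ) m) = fun _ => 1 :=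
      funext fun m => njlCapZ_zero' N m
    have hsum : (2 * N * ∑ y, njlCapZdrop N (0 : TorusSite ν L →₀ ℕ) y m : ℂ) = 0 := by
      simp [njlCapZdrop]
    rw [hfun, hsum]
    exact hasDerivAt_const m 1
  · obtain ⟨z, hz⟩ := Finsupp.support_nonempty_iff.2 h0
    set c' := c - Finsupp.single z 1 with hc'def
    have hdeg' : c'.degree < n := by
      have := degree_sub_single_add_one' hz; rw [← hc'def] at this; omega
    have hc' : ∀ x, c' x ≤ N := tsub_apply_le' hc _
    -- induction hypothesis for `c'` and for the dropped partition functions of `c'`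
    have hZ' : HasDerivAt (fun m => njlCapZ N c' m) (2 * N * ∑ y, njlCapZdrop N c' y m) m :=
      ih _ hdeg' c' rfl hc' m
    have hZd : ∀ w, HasDerivAt (fun m => njlCapZdrop N c' w m)
        (if w ∈ c'.support then 2 * N * ∑ u, njlCapZdrop N (c' - Finsupp.single w 1) u m else 0) m := by
      intro w
      by_cases hw : w ∈ c'.support
      · simp only [njlCapZdrop, hw, if_true]
        have hdeg'' : (c' - Finsupp.single w 1).degree < n := by
          have := degree_sub_single_add_one' hw; omega
        exact ih _ hdeg'' _ rfl (tsub_apply_le' hc' _) m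
      · simp only [njlCapZdrop, hw, if_false]
        exact hasDerivAt_const m 0
    -- derivative of the right-hand side of the recursion
    have hlin : HasDerivAt (fun m : ℂ => 2 * N * m) (2 * N) m := by
      simpa using (hasDerivAt_id m).const_mul (2 * (N : ℂ))
    have hrhs : HasDerivAt (fun m => 2 * N * m * njlCapZ N c' m +
        N * ∑ μ : Fin ν, (njlCapZdrop N c' (z + Pi.single μ 1) m + njlCapZdrop N c' (z - Pi.single μ 1) m))
        (2 * N * njlCapZ N c' m + 2 * N * m * (2 * N * ∑ y, njlCapZdrop N c' y m) +
          N * ∑ μ : Fin ν,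
            ((if z + Pi.single μ 1 ∈ c'.support then
                2 * N * ∑ u, njlCapZdrop N (c' - Finsupp.single (z + Pi.single μ 1) 1) u m else 0) +
              (if z - Pi.single μ 1 ∈ c'.support then
                2 * N * ∑ u, njlCapZdrop N (c' - Finsupp.single (z - Pi.single μ 1) 1) u m else 0))) m := by
      refine (hlin.mul hZ').add (HasDerivAt.const_mul (N : ℂ) (HasDerivAt.fun_sum fun μ _ => ?_))
      exact (hZd (z + Pi.single μ 1)).add (hZd (z - Pi.single μ 1))
    -- transport through the recursion `c_z Z(c) = RHS`
    have hprod : HasDerivAt (fun m => (c z : ℂ) * njlCapZ N c m)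
        (2 * N * njlCapZ N c' m + 2 * N * m * (2 * N * ∑ y, njlCapZdrop N c' y m) +
          N * ∑ μ : Fin ν,
            ((if z + Pi.single μ 1 ∈ c'.support then
                2 * N * ∑ u, njlCapZdrop N (c' - Finsupp.single (z + Pi.single μ 1) 1) u m else 0) +
              (if z - Pi.single μ 1 ∈ c'.support then
                2 * N * ∑ u, njlCapZdrop N (c' - Finsupp.single (z - Pi.single μ 1) 1) u m else 0))) m := by
      refine hrhs.congr_of_eventuallyEq (Eventually.of_forall fun m' => ?_)
      have h := njlCapZ_rec N hc hz m'
      simp only [njlCapZdrop, hc'def] at h ⊢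
      exact h
    have hcz : (c z : ℂ) ≠ 0 := by exact_mod_cast Finsupp.mem_support_iff.1 hz
    have hZ : HasDerivAt (fun m => njlCapZ N c m)
        ((c z : ℂ)⁻¹ * (2 * N * njlCapZ N c' m + 2 * N * m * (2 * N * ∑ y, njlCapZdrop N c' y m) +
          N * ∑ μ : Fin ν,
            ((if z + Pi.single μ 1 ∈ c'.support then
                2 * N * ∑ u, njlCapZdrop N (c' - Finsupp.single (z + Pi.single μ 1) 1) u m else 0) +
              (if z - Pi.single μ 1 ∈ c'.support then
                2 * N * ∑ u, njlCapZdrop N (c' - Finsupp.single (z - Pi.single μ 1) 1) u m else 0)))) m := by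
      refine (hprod.const_mul ((c z : ℂ)⁻¹)).congr_of_eventuallyEq (Eventually.of_forall fun m' => ?_)
      simp only
      rw [← mul_assoc, inv_mul_cancel₀ hcz, one_mul]
    refine hZ.congr_deriv ?_
    -- the summed recursion identity
    have hid := natCast_mul_sum_njlCapZdrop_eq (N := N) hc hz m
    rw [← hc'def] at hid
    rw [inv_mul_eq_iff_eq_mul₀ hcz]
    have hpull : ∀ (P : Prop) [Decidable P] (S : ℂ),
        (if P then 2 * N * S else 0) = 2 * N * (if P then S else 0) := by
      intro P _ S; split_ifs <;> simp
    simp_rw [hpull, ← mul_add, ← Finset.mul_sum]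
    linear_combination (-(2 * (N : ℂ))) * hid

/-- **`d/dm` of the dropped partition functions.** [cite: HeilmannLieb1972, (2.9)–(2.12) and (4.11)] -/
theorem hasDerivAt_njlCapZdrop (c : TorusSite ν L →₀ ℕ) (hc : ∀ x, c x ≤ N) (y : TorusSite ν L)
    (m : ℂ) :
    HasDerivAt (fun m => njlCapZdrop N c y m)
      (if y ∈ c.support then 2 * N * ∑ u, njlCapZdrop N (c - Finsupp.single y 1) u m else 0) m := by
  classical
  by_cases hy : y ∈ c.support
  · simp only [njlCapZdrop, hy, if_true]
    exact hasDerivAt_njlCapZ _ (tsub_apply_le' hc _) m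
  · simp only [njlCapZdrop, hy, if_false]
    exact hasDerivAt_const m 0

/-- The partition functions are differentiable (indeed polynomial) in the mass. [cite: SalmhoferSeiler1991, Cor. 3.9] -/
theorem differentiable_njlCapZ (c : TorusSite ν L →₀ ℕ) (hc : ∀ x, c x ≤ N) :
    Differentiable ℂ (fun m => njlCapZ N c m) :=
  fun m => (hasDerivAt_njlCapZ c hc m).differentiableAt

/-! ### The fluctuation formula for the one-point function -/

/-- **Fluctuation formula**: in the zero-free region (`‖m‖ ≥ √(2ν)`, `m ≠ 0`, or more generally
wherever `Z_Λ(N)(m) ≠ 0`), `d/dm ⟨σ_z⟩_Λ(m) = 2N ∑_y (Zd(N-δ_z, y)/Z - ⟨σ_z⟩ ⟨σ_y⟩)`, i.e.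
`2N ∑_y (⟨σ_zσ_y⟩_Λ - ⟨σ_z⟩_Λ⟨σ_y⟩_Λ)` (with `⟨σ_z²⟩ = 0` for `N = 1`). [cite: SalmhoferSeiler1991, (3.46) and (4.10)][cite: HeilmannLieb1972, (2.9)–(2.12)] -/
theorem hasDerivAt_njlCapRatio_top (hN : 1 ≤ N) (z : TorusSite ν L) {m : ℂ}
    (hZ : njlCapZ N (topExponent (ν := ν) (L := L) N) m ≠ 0) :
    HasDerivAt (fun m => njlCapRatio N z (topExponent (ν := ν) (L := L) N) m)
      (2 * N * ∑ y, (njlCapZdrop N (topExponent N - Finsupp.single z 1) y m /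
          njlCapZ N (topExponent (ν := ν) (L := L) N) m -
        njlCapRatio N z (topExponent (ν := ν) (L := L) N) m *
          njlCapRatio N y (topExponent (ν := ν) (L := L) N) m)) m := by
  classical
  have htop : ∀ x, topExponent (ν := ν) (L := L) N x ≤ N := fun x => (topExponent_apply' N x).le
  have hc' : ∀ x, (topExponent (ν := ν) (L := L) N - Finsupp.single z 1 : TorusSite ν L →₀ ℕ) x ≤ N :=
    tsub_apply_le' htop _
  have h1 := hasDerivAt_njlCapZ (topExponent N - Finsupp.single z 1) hc' m
  have h2 := hasDerivAt_njlCapZ (topExponent (ν := ν) (L := L) N) htop m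
  have h := h1.div h2 hZ
  unfold njlCapRatio
  refine h.congr_deriv ?_
  -- `Zd(N, y) = Z(N - δ_y)` since every site has capacity `N ≥ 1`
  have hdrop : ∀ y, njlCapZdrop N (topExponent (ν := ν) (L := L) N) y m =
      njlCapZ N (topExponent N - Finsupp.single y 1) m := by
    intro y
    have hy : y ∈ (topExponent (ν := ν) (L := L) N).support := by
      rw [Finsupp.mem_support_iff, topExponent_apply']; omega
    simp [njlCapZdrop, hy]
  simp_rw [hdrop]
  rw [div_eq_iff (pow_ne_zero 2 hZ)]
  simp only [Finset.mul_sum, Finset.sum_mul, ← Finset.sum_sub_distrib]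
  refine Finset.sum_congr rfl fun y _ => ?_
  field_simp

/-! ### The uniform susceptibility bound -/

/-- **Cauchy's estimate for the one-point function**: for real `m > 0`, in every volume,
`|d/dm ⟨σ_z⟩_Λ(m)| ≤ 2/m²` (the one-point function is holomorphic on `|m' - m| < m/2` with the
volume-independent bound `(2 Re m')⁻¹ ≤ 1/m` of the Erratum). [cite: SalmhoferSeiler1992Erratum, (5)][cite: HeilmannLieb1972, Lemma 4.7] -/
theorem norm_deriv_njlCorrelation_single_le (hN : 1 ≤ N) (z : Site ν) {m : ℝ} (hm : 0 < m) :
    ‖deriv (njlCorrelation N L (Finsupp.single z 1)) (m : ℂ)‖ ≤ 2 / m ^ 2 := by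
  have hR : 0 < m / 2 := by positivity
  -- holomorphy on the closed disc `|m' - m| ≤ m/2` (inside `Re m' > 0`)
  have hsub : closedBall (m : ℂ) (m / 2) ⊆ njlMassRegion ν := by
    intro w hw
    refine Or.inl ?_
    have h1 : |w.re - m| ≤ ‖w - m‖ := by
      simpa using Complex.abs_re_le_norm (w - m)
    have h2 : ‖w - (m : ℂ)‖ ≤ m / 2 := mem_closedBall_iff_norm.1 hw
    have := abs_le.1 (h1.trans h2)
    intro h0; rw [h0] at this; linarith [this.1]
  have hd : DiffContOnCl ℂ (njlCorrelation N L (Finsupp.single z 1)) (ball (m : ℂ) (m / 2)) := by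
    refine DifferentiableOn.diffContOnCl ?_
    rw [closure_ball _ hR.ne']
    exact (differentiableOn_njlCorrelation N L _).mono hsub
  refine (Complex.norm_deriv_le_of_forall_mem_sphere_norm_le hR hd (C := 1 / m) fun w hw => ?_).trans
    (le_of_eq ?_)
  · -- on the circle: `Re w ≥ m/2`, so `|⟨σ_z⟩_Λ(w)| ≤ (2 Re w)⁻¹ ≤ 1/m`
    have hw' : ‖w - (m : ℂ)‖ = m / 2 := mem_sphere_iff_norm.1 hw
    have h1 : |w.re - m| ≤ ‖w - m‖ := by simpa using Complex.abs_re_le_norm (w - m)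
    have hre : m / 2 ≤ w.re := by
      have := abs_le.1 (h1.trans hw'.le); linarith [this.1]
    have hre0 : w.re ≠ 0 := by intro h; rw [h] at hre; linarith
    have hb := norm_njlExpectC_monomial_le_of_re (ν := ν) (L := L) hN hre0
      (Finsupp.mapDomain (Torus.proj L) (Finsupp.single z 1))
    rw [Finsupp.mapDomain_single, Finsupp.degree_single, pow_one] at hb
    refine (show ‖njlCorrelation N L (Finsupp.single z 1) w‖ ≤ (2 * |w.re|)⁻¹ from ?_).trans ?_
    · unfold njlCorrelation; rw [Finsupp.mapDomain_single]; exact hb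
    · rw [abs_of_pos (by linarith), one_div]
      exact inv_anti₀ hm (by linarith)
  · field_simp

/-- **The uniform susceptibility bound (clustering on average at `m > 0`).**  For the NJL system
(`N ≥ 1`) on any torus, a lattice point `z` and a real mass `m > 0`:
`|∑_y (⟨σ_zσ_y⟩_Λ(m) - ⟨σ_z⟩_Λ(m)⟨σ_y⟩_Λ(m))| ≤ 1/(N m²)` — the truncated two-point function is
summable over the volume with a bound independent of `Λ` (here `⟨σ_zσ_y⟩ = Zd(N-δ_z, y)/Z`, which is
the pair correlation for `y ≠ z` and `⟨σ_z²⟩` for `y = z`).  This is the boundedness of the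
susceptibility that makes the `k = 0` mode of (4.13) harmless ("`T̂ = C(0)s²δ + ĝ`"), obtained in
the paper from Thm. 3.11. [cite: SalmhoferSeiler1991, Thm. 4.3 (proof, (4.13)–(4.15))][cite: SalmhoferSeiler1992Erratum, (5)] -/
theorem njl_susceptibility_bound (hN : 1 ≤ N) (z : Site ν) {m : ℝ} (hm : 0 < m) :
    ‖∑ y : TorusSite ν L,
      (njlCapZdrop N (topExponent N - Finsupp.single (Torus.proj L z) 1) y (m : ℂ) /
          njlCapZ N (topExponent (ν := ν) (L := L) N) (m : ℂ) -
        njlCapRatio N (Torus.proj L z) (topExponent (ν := ν) (L := L) N) (m : ℂ) *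
          njlCapRatio N y (topExponent (ν := ν) (L := L) N) (m : ℂ))‖ ≤ 1 / (N * m ^ 2) := by
  have hN' : (0 : ℝ) < N := by exact_mod_cast hN
  have hZ : njlCapZ N (topExponent (ν := ν) (L := L) N) (m : ℂ) ≠ 0 := by
    have h := njlPartitionFunctionC_ne_zero_of_re_ne_zero (ν := ν) (L := L) N (m := (m : ℂ))
      (by rw [Complex.ofReal_re]; exact hm.ne')
    rwa [njlPartitionFunctionC_eq_Z] at h
  have hderiv := hasDerivAt_njlCapRatio_top (ν := ν) (L := L) hN (Torus.proj L z) hZ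
  -- the ratio is the one-point function `njlCorrelation N L (δ_z)`
  have hfun : (fun m => njlCapRatio N (Torus.proj L z) (topExponent (ν := ν) (L := L) N) m) =
      njlCorrelation N L (Finsupp.single z 1) :=
    funext fun m => (njlCorrelation_single_eq_njlCapRatio hN z m).symm
  rw [hfun] at hderiv
  have hb := norm_deriv_njlCorrelation_single_le (ν := ν) (L := L) hN z hm
  rw [hderiv.deriv, norm_mul] at hb
  have h2N : ‖(2 * N : ℂ)‖ = 2 * N := by
    rw [norm_mul, Complex.norm_two, Complex.norm_natCast]
  rw [h2N] at hb
  rw [show 1 / (N * m ^ 2) = (2 / m ^ 2) / (2 * N) by field_simp]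
  rw [le_div_iff₀ (by positivity)]
  linarith

end Derivative

end ComplexSpin

end Literature.MathematicalPhysics.StatisticalMechanics
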